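import Literature.Analysis.FluidPDE.PassiveScalarForcedEnergyKinetic
import HarnessLib

/-!
# Time-integrated renormalisation limits for SOURCED weak passive scalars

Analysis/FluidPDE proof-support file (everything proved). The limit passages, integrated over a
time interval `(0, t]`, of the DiPerna–Lions renormalisation argument (DiPerna–Lions 1989, §II.3,
Thm. II.3) for a weak solution `θ ∈ L^∞(0,T; L²(T^d))` of the steadily sourced passive scalar
equation `∂ₜθ + u·∇θ = κΔθ + f` (`Torus.IsWeakScalarTransportForcedOn T κ u (fun _ => f) θ₀ θ`,
any `κ`, any drift of the class) that do not see the drift; they combine the slice-wise lemmas of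
`PassiveScalarForcedEnergyKinetic` (`Torus.tendsto_integral_renormDeriv_mul`,
`Torus.tendsto_integral_renormDeriv_mul_atTop`) with dominated convergence in time, so that the
conservative `κ = 0` balance (`PassiveScalarForcedTransportEnergy`) and other energy budgets can
share them:

* `Torus.tendsto_integral_comp_of_lipschitzWith` — `∫ β(Aₙ) → ∫ β(g)` for a Lipschitz `β` when
  `Aₙ → g` in `L²(T^d)` (e.g. `Aₙ = g ⋆ kₙ`, `Torus.tendsto_eLpNorm_convolution_sub_self`);
* `IsWeakScalarTransportForcedOn.integrable_integral_renormDeriv_molInt_mul_sourceMol` — the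
  renormalised mollified source pairing `τ ↦ ∫ β_M'((θ(τ) ⋆ k)(x)) (f ⋆ k)(x) dx` is integrable
  on `(0,T)`;
* `IsWeakScalarTransportForcedOn.tendsto_setIntegral_renormDeriv_molInt_mul_sourceMol` —
  `∫_{(0,t]} ∫ β_M'(θ ⋆ kₙ)(f ⋆ kₙ) → ∫_{(0,t]} ∫ β_M'(θ) f` as `n → ∞` along mollifiers
  `kₙ = Torus.kernel εₙ`, `εₙ → 0`;
* `IsWeakScalarTransportForcedOn.tendsto_setIntegral_renormDeriv_mul_source` —
  `∫_{(0,t]} ∫ β_M'(θ) f → 2 ∫_{(0,t]} ∫ θ f` as `M → ∞`.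

## References

* R. J. DiPerna, P.-L. Lions, *Ordinary differential equations, transport theory and Sobolev
  spaces*, Invent. Math. 98 (1989), 511–547, §II.3, Thm. II.3. [`DiPernaLions1989`]
-/

noncomputable section

open MeasureTheory TopologicalSpace Set Function Filter Topology Metric ContinuousLinearMap
  UnitAddTorus
open scoped ENNReal NNReal Convolution ContDiff InnerProductSpace

namespace Literature.Analysis.FluidPDE

namespace Torus

variable {d : Type*} [Fintype d]

/-! ## Lipschitz functions of `L²`-convergent sequences -/

/-- **`∫ β(Aₙ) → ∫ β(g)`** for a Lipschitz `β : ℝ → ℝ` when `Aₙ → g` in `L²(T^d)`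
(`‖β ∘ Aₙ - β ∘ g‖_{L¹} ≤ K ‖Aₙ - g‖_{L¹} ≤ K ‖Aₙ - g‖_{L²}` on the probability space `T^d`, and
`L¹` convergence of the integrands). [folklore] -/
theorem tendsto_integral_comp_of_lipschitzWith {β : ℝ → ℝ} {K : ℝ≥0} (hβ : LipschitzWith K β)
    {g : UnitAddTorus d → ℝ} (hg : MemLp g 2 volume) {A : ℕ → UnitAddTorus d → ℝ}
    (hA : ∀ n, MemLp (A n) 2 volume)
    (hlim : Tendsto (fun n => eLpNorm (A n - g) 2 volume) atTop (𝓝 0)) :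
    Tendsto (fun n => ∫ x, β (A n x)) atTop (𝓝 (∫ x, β (g x))) := by
  have hint : ∀ {φ : UnitAddTorus d → ℝ}, MemLp φ 2 volume → Integrable (fun x => β (φ x)) volume := by
    intro φ hφ
    have hφi : Integrable φ volume := hφ.integrable one_le_two
    refine Integrable.mono' ((hφi.norm.const_mul K).add (integrable_const ‖β 0‖))
      (hβ.continuous.comp_aestronglyMeasurable hφi.aestronglyMeasurable) (Eventually.of_forall fun x => ?_)
    have h1 := hβ.dist_le_mul (φ x) 0
    rw [Real.dist_eq, Real.dist_eq, sub_zero] at h1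
    calc ‖β (φ x)‖ = |(β (φ x) - β 0) + β 0| := by rw [Real.norm_eq_abs, sub_add_cancel]
      _ ≤ |β (φ x) - β 0| + |β 0| := abs_add_le _ _
      _ ≤ K * ‖φ x‖ + ‖β 0‖ := by rw [Real.norm_eq_abs, Real.norm_eq_abs]; linarith
  refine tendsto_integral_of_L1 (fun x => β (g x)) (hint hg).aestronglyMeasurable
    (Eventually.of_forall fun n => hint (hA n)) ?_
  have hb : ∀ n, ∫⁻ x, ‖β (A n x) - β (g x)‖ₑ ≤ K * eLpNorm (A n - g) 2 volume := fun n =>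
    calc ∫⁻ x, ‖β (A n x) - β (g x)‖ₑ ≤ ∫⁻ x, K * ‖(A n - g) x‖ₑ := lintegral_mono fun x => by
            have := hβ.edist_le_mul (A n x) (g x)
            rwa [edist_eq_enorm_sub, edist_eq_enorm_sub] at this
      _ = K * eLpNorm (A n - g) 1 volume := by
            rw [lintegral_const_mul' _ _ ENNReal.coe_ne_top, eLpNorm_one_eq_lintegral_enorm]
      _ ≤ K * eLpNorm (A n - g) 2 volume := by
            gcongr
            exact eLpNorm_le_eLpNorm_of_exponent_le (by norm_num) ((hA n).sub hg).1
  refine tendsto_of_tendsto_of_tendsto_of_le_of_le tendsto_const_nhds ?_ (fun n => zero_le) hb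
  have := ENNReal.Tendsto.const_mul hlim (Or.inr ENNReal.coe_ne_top : (0 : ℝ≥0∞) ≠ 0 ∨ (K : ℝ≥0∞) ≠ ⊤)
  rwa [mul_zero] at this

/-! ## The renormalised source pairings, integrated in time -/

namespace IsWeakScalarTransportForcedOn

variable {T κ : ℝ} {u : ℝ → UnitAddTorus d → EuclideanSpace ℝ d} {f θ₀ : UnitAddTorus d → ℝ}
  {θ : ℝ → UnitAddTorus d → ℝ}

/-- The renormalised mollified source pairing `τ ↦ ∫ β_M'((θ(τ) ⋆ k)(x)) (f ⋆ k)(x) dx` is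
integrable on `(0,T)` (jointly measurable and bounded: `|β_M'| ≤ 4(rIn + 1)`, `f ⋆ k` continuous).
[folklore] -/
theorem integrable_integral_renormDeriv_molInt_mul_sourceMol
    (h : IsWeakScalarTransportForcedOn T κ u (fun _ => f) θ₀ θ) (hf : FunctionSpaces.Torus.IsSmooth f)
    {k : UnitAddTorus d → ℝ} (hk : FunctionSpaces.Torus.IsSmooth k) (M : ℝ) :
    Integrable (fun τ => ∫ x, Calculus.renormDeriv M (∫ y, θ τ y * k (x - y)) * ∫ y, f y * k (x - y))
      (volume.restrict (Set.Ioo 0 T)) := by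
  have hS : Continuous fun x => ∫ y, f y * k (x - y) := by
    have e : (fun x => ∫ y, f y * k (x - y)) = f ⋆ k := by
      funext x; simp only [convolution_lsmul, smul_eq_mul]
    rw [e]
    exact FunctionSpaces.Torus.continuous_convolution hf.continuous.integrable_unitAddTorus hk.continuous
  obtain ⟨CS, hCS⟩ := FunctionSpaces.Torus.exists_forall_norm_le_of_continuous hS
  have hR := (Calculus.truncCutoff M).rIn_pos
  have hm : AEStronglyMeasurable (Function.uncurry fun τ x =>
      Calculus.renormDeriv M (∫ y, θ τ y * k (x - y)) * ∫ y, f y * k (x - y))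
      ((volume.restrict (Set.Ioo 0 T)).prod volume) :=
    ((Calculus.continuous_renormDeriv M).comp_aestronglyMeasurable
      (h.aestronglyMeasurable_uncurry_molInt₁ hk.continuous)).mul
      (hS.comp_aestronglyMeasurable measurable_snd.aestronglyMeasurable)
  refine Integrable.mono' (integrable_const (4 * ((Calculus.truncCutoff M).rIn + 1) * CS))
    hm.integral_prod_right' (Eventually.of_forall fun τ => ?_)
  refine (norm_integral_le_of_norm_le_const (Eventually.of_forall fun x => ?_)).trans
    (le_of_eq (by rw [probReal_univ, mul_one]))
  rw [norm_mul, Real.norm_eq_abs]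
  exact mul_le_mul (Calculus.abs_renormDeriv_le_const M _) (hCS x) (norm_nonneg _) (by positivity)

/-- **The mollified source pairing as `n → ∞`, integrated in time** (DiPerna–Lions 1989, §II.3,
proof of Thm. II.3, the source term): for a weak solution `θ ∈ L^∞(0,T;L²)` of the steadily
sourced equation with smooth source `f`, mollifiers `kₙ = Torus.kernel εₙ` (`0 < εₙ ≤ 1/4`,
`εₙ → 0`), `M : ℝ` and `t ∈ (0,T)`,
`∫_{(0,t]} ∫ β_M'((θ(τ) ⋆ kₙ)(x)) (f ⋆ kₙ)(x) dx dτ → ∫_{(0,t]} ∫ β_M'(θ(τ,x)) f(x) dx dτ`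
(slice-wise `Torus.tendsto_integral_renormDeriv_mul` at the a.e. `τ` with `θ(τ) ∈ L²`, where
`θ(τ) ⋆ kₙ → θ(τ)` in `L²` and `f ⋆ kₙ → f` uniformly; dominated convergence in `τ` with the bound
`4(rIn + 1) sup|f|`). [cite: DiPernaLions1989, §II.3 Thm. II.3] -/
theorem tendsto_setIntegral_renormDeriv_molInt_mul_sourceMol
    (h : IsWeakScalarTransportForcedOn T κ u (fun _ => f) θ₀ θ) (hf : FunctionSpaces.Torus.IsSmooth f)
    {ε : ℕ → ℝ} (hε : ∀ n, 0 < ε n) (hε' : ∀ n, ε n ≤ 1 / 4) (hε0 : Tendsto ε atTop (𝓝 0))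
    (M : ℝ) {t : ℝ} (ht : t ∈ Set.Ioo 0 T) :
    Tendsto (fun n => ∫ τ in Set.Ioc 0 t, ∫ x,
        Calculus.renormDeriv M (∫ y, θ τ y * FunctionSpaces.Torus.kernel (ε n) (x - y)) *
          ∫ y, f y * FunctionSpaces.Torus.kernel (ε n) (x - y))
      atTop (𝓝 (∫ τ in Set.Ioc 0 t, ∫ x, Calculus.renormDeriv M (θ τ x) * f x)) := by
  haveI : (volume : Measure (UnitAddTorus d)).IsNegInvariant := Pi.isNegInvariant_volume
  set μT : Measure ℝ := (volume : Measure ℝ).restrict (Set.Ioo 0 T) with hμT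
  haveI : IsFiniteMeasure μT := by rw [hμT]; infer_instance
  set kk : ℕ → UnitAddTorus d → ℝ := fun n => FunctionSpaces.Torus.kernel (d := d) (ε n) with hkk
  have hkS : ∀ n, FunctionSpaces.Torus.IsSmooth (kk n) := fun n =>
    FunctionSpaces.Torus.isSmooth_kernel (hε n) (hε' n)
  have hk0 : ∀ n y, 0 ≤ kk n y := fun n y => FunctionSpaces.Torus.kernel_nonneg (hε n).le y
  have hkint : ∀ n, ∫ y, kk n y = 1 := fun n => FunctionSpaces.Torus.integral_kernel (hε n) (hε' n)
  have hconv : ∀ (δ : UnitAddTorus d → ℝ) (n : ℕ) (x : UnitAddTorus d), (δ ⋆ kk n) x = ∫ y, δ y * kk n (x - y) :=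
    fun δ n x => by simp only [convolution_lsmul, smul_eq_mul]
  -- the mollified source: continuity, sup bound, uniform convergence
  obtain ⟨Cf, hCf⟩ := FunctionSpaces.Torus.exists_forall_norm_le_of_continuous hf.continuous
  set Sn : ℕ → UnitAddTorus d → ℝ := fun n x => ∫ y, f y * kk n (x - y) with hSn_def
  have hSn_conv : ∀ n, Sn n = f ⋆ kk n := fun n => by
    funext x; simp only [hSn_def, convolution_lsmul, smul_eq_mul]
  have hSn_cont : ∀ n, Continuous (Sn n) := fun n => by
    rw [hSn_conv n]
    exact FunctionSpaces.Torus.continuous_convolution hf.continuous.integrable_unitAddTorus (hkS n).continuous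
  have hSn_le : ∀ n x, |Sn n x| ≤ Cf := fun n x =>
    abs_molInt_le_of_norm_le hf.continuous (hkS n).continuous (hk0 n) (hkint n) hCf x
  have hSn_unif : ∀ η : ℝ, 0 < η → ∀ᶠ n in atTop, ∀ x, |Sn n x - f x| ≤ η := by
    intro η hη
    obtain ⟨δ, hδ, hδP⟩ := FunctionSpaces.Torus.exists_forall_dist_convolution_le hf.continuous hη
    filter_upwards [(tendsto_order.1 hε0).2 δ hδ] with n hn x
    have hsupp : Function.support (kk n) ⊆ Metric.ball 0 δ :=
      (FunctionSpaces.Torus.support_kernel_subset (hε n)).trans (Metric.ball_subset_ball hn.le)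
    have := hδP hsupp (hk0 n) (hkint n) x
    rwa [← FunctionSpaces.Torus.convolution_comm_real, ← hSn_conv n, Real.dist_eq] at this
  -- the pairings: measurability and the uniform bound
  set Cβ : ℝ := 4 * ((Calculus.truncCutoff M).rIn + 1) with hCβ
  have hCβ0 : 0 ≤ Cβ := by have := (Calculus.truncCutoff M).rIn_pos; rw [hCβ]; positivity
  set Q : ℕ → ℝ → ℝ := fun n τ => ∫ x, Calculus.renormDeriv M (∫ y, θ τ y * kk n (x - y)) * Sn n x with hQ_def
  have hQm : ∀ n, AEStronglyMeasurable (Q n) μT := fun n =>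
    (h.integrable_integral_renormDeriv_molInt_mul_sourceMol hf (hkS n) M).aestronglyMeasurable
  have hQb : ∀ n τ, |Q n τ| ≤ Cβ * Cf := by
    intro n τ
    rw [← Real.norm_eq_abs]
    refine (norm_integral_le_of_norm_le_const (C := Cβ * Cf) (Eventually.of_forall fun x => ?_)).trans
      (le_of_eq ?_)
    · rw [norm_mul, Real.norm_eq_abs, Real.norm_eq_abs]
      exact mul_le_mul (Calculus.abs_renormDeriv_le_const M _) (hSn_le n x) (abs_nonneg _) hCβ0
    · rw [probReal_univ, mul_one]
  -- slice-wise convergence at the good `τ`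
  have hQlim : ∀ᵐ τ ∂μT, Tendsto (fun n => Q n τ) atTop (𝓝 (∫ x, Calculus.renormDeriv M (θ τ x) * f x)) := by
    filter_upwards [h.ae_memLp_two] with τ hθ2
    have hθi : Integrable (θ τ) volume := hθ2.integrable one_le_two
    have hA : ∀ n, Continuous (θ τ ⋆ kk n) := fun n =>
      FunctionSpaces.Torus.continuous_convolution hθi (hkS n).continuous
    have hE0 : Tendsto (fun n => eLpNorm (θ τ ⋆ kk n - θ τ) 2 volume) atTop (𝓝 0) :=
      FunctionSpaces.Torus.tendsto_eLpNorm_convolution_sub_self hθ2 hk0 hkint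
        (fun n => FunctionSpaces.Torus.support_kernel_subset (hε n))
        (fun n => FunctionSpaces.Torus.continuous_kernel (hε n) (hε' n)) hε0
    have e : (fun n => Q n τ) = fun n => ∫ x, Calculus.renormDeriv M ((θ τ ⋆ kk n) x) * Sn n x :=
      funext fun n => by simp only [hQ_def, hconv]
    rw [e]
    exact tendsto_integral_renormDeriv_mul M hθ2 hA hf.continuous hSn_cont hSn_le hE0 hSn_unif
  -- dominated convergence in `τ ∈ (0, t]`
  have hsub : Set.Ioc 0 t ⊆ Set.Ioo 0 T := Set.Ioc_subset_Ioo_right ht.2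
  have hle : (volume : Measure ℝ).restrict (Set.Ioc 0 t) ≤ μT := Measure.restrict_mono_set _ hsub
  refine tendsto_integral_of_dominated_convergence (fun _ => Cβ * Cf) (fun n => (hQm n).mono_measure hle)
    (integrable_const _) (fun n => Eventually.of_forall fun τ => ?_)
    (ae_restrict_of_ae_restrict_of_subset hsub hQlim)
  rw [Real.norm_eq_abs]
  exact hQb n τ

/-- **The renormalised source pairing as `M → ∞`, integrated in time** (DiPerna–Lions 1989,
§II.3, proof of Thm. II.3, removal of the renormalisation): for `t ∈ (0,T)`,
`∫_{(0,t]} ∫ β_M'(θ(τ,x)) f(x) dx dτ → 2 ∫_{(0,t]} ∫ θ(τ,x) f(x) dx dτ` (slice-wise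
`Torus.tendsto_integral_renormDeriv_mul_atTop`; dominated convergence in `τ` with the bound
`2 sup|f| sup_τ ‖θ(τ)‖_{L²}`). [cite: DiPernaLions1989, §II.3 Thm. II.3] -/
theorem tendsto_setIntegral_renormDeriv_mul_source
    (h : IsWeakScalarTransportForcedOn T κ u (fun _ => f) θ₀ θ) (hf : FunctionSpaces.Torus.IsSmooth f)
    {t : ℝ} (ht : t ∈ Set.Ioo 0 T) :
    Tendsto (fun M : ℕ => ∫ τ in Set.Ioc 0 t, ∫ x, Calculus.renormDeriv (M : ℝ) (θ τ x) * f x) atTop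
      (𝓝 (2 * ∫ τ in Set.Ioc 0 t, ∫ x, θ τ x * f x)) := by
  set μT : Measure ℝ := (volume : Measure ℝ).restrict (Set.Ioo 0 T) with hμT
  haveI : IsFiniteMeasure μT := by rw [hμT]; infer_instance
  obtain ⟨Cf, hCf⟩ := FunctionSpaces.Torus.exists_forall_norm_le_of_continuous hf.continuous
  have hCf0 : 0 ≤ Cf := (norm_nonneg _).trans (hCf 0)
  obtain ⟨C₁, hC₁⟩ := h.exists_eLpNorm_le
  set QM : ℕ → ℝ → ℝ := fun M τ => ∫ x, Calculus.renormDeriv (M : ℝ) (θ τ x) * f x with hQM_def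
  have hQMm : ∀ M, AEStronglyMeasurable (QM M) μT := by
    intro M
    have hm : AEStronglyMeasurable (Function.uncurry fun τ x => Calculus.renormDeriv (M : ℝ) (θ τ x) * f x)
        (μT.prod volume) :=
      ((Calculus.continuous_renormDeriv (M : ℝ)).comp_aestronglyMeasurable h.aestronglyMeasurable_uncurry).mul
        (hf.continuous.comp_aestronglyMeasurable measurable_snd.aestronglyMeasurable)
    exact hm.integral_prod_right'
  have hQMb : ∀ M, ∀ᵐ τ ∂μT, ‖QM M τ‖ ≤ 2 * Cf * C₁ := by
    intro M
    filter_upwards [h.ae_memLp_two, hC₁] with τ hθ2 hθC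
    rw [Real.norm_eq_abs]
    exact (abs_integral_renormDeriv_mul_le (M : ℝ) (hθ2.integrable one_le_two) hCf).trans
      (mul_le_mul_of_nonneg_left (integral_abs_le_of_eLpNorm_le hθ2 hθC) (by positivity))
  have hQMlim : ∀ᵐ τ ∂μT, Tendsto (fun M : ℕ => QM M τ) atTop (𝓝 (2 * ∫ x, θ τ x * f x)) := by
    filter_upwards [h.ae_memLp_two] with τ hθ2
    exact tendsto_integral_renormDeriv_mul_atTop (hθ2.integrable one_le_two) hf.continuous
  -- dominated convergence in `τ ∈ (0, t]`
  have hsub : Set.Ioc 0 t ⊆ Set.Ioo 0 T := Set.Ioc_subset_Ioo_right ht.2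
  have hle : (volume : Measure ℝ).restrict (Set.Ioc 0 t) ≤ μT := Measure.restrict_mono_set _ hsub
  rw [show 2 * (∫ τ in Set.Ioc 0 t, ∫ x, θ τ x * f x) = ∫ τ in Set.Ioc 0 t, 2 * ∫ x, θ τ x * f x from
    (MeasureTheory.integral_const_mul _ _).symm]
  exact tendsto_integral_of_dominated_convergence (fun _ => 2 * Cf * C₁) (fun M => (hQMm M).mono_measure hle)
    (integrable_const _) (fun M => ae_restrict_of_ae_restrict_of_subset hsub (hQMb M))
    (ae_restrict_of_ae_restrict_of_subset hsub hQMlim)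

end IsWeakScalarTransportForcedOn

end Torus

end Literature.Analysis.FluidPDE
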